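import Literature.MathematicalPhysics.QuantumFieldTheory.Balaban1983to89.B8SockHFPTorusTraceFree
import Literature.MathematicalPhysics.QuantumFieldTheory.Balaban1983to89.B8Prop5KLevelLetters
import Literature.MathematicalPhysics.QuantumFieldTheory.Balaban1983to89.B8SockHFPCubeMember
import Literature.MathematicalPhysics.QuantumFieldTheory.Balaban1983to89.B8CubeMemberZd
import Literature.MathematicalPhysics.QuantumFieldTheory.Balaban1983to89.B8Thm4TruncationLocal
import Literature.MathematicalPhysics.QuantumFieldTheory.Balaban1983to89.B8Prop5ExistsZdLan
import Summits.QuantumFields.YangMills.Theorems.UnitScaleTiltHalvingP1FlatCoreSupplierInduction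
import HarnessLib

/-!
# `hP1room` PROGRAMME (LEAD-H BOARD v5 «H = hSockets₁′ ∧ hSockets₂′», LEAD-H g5 `LOCATE-K-SOCK` «the row AFTER (K-final)»), ROW (K-sock) FILE A:
# ★★ THEOREM 4's RAW PROPOSITION-5 SOCKETS `hP5base` ∕ `hP5` IN `G`-FORM AT N05's CUBE MEMBER OF RECORD, FLAT BACKGROUND, FROM THE [4] LETTERS (+ their `τ`-laws)
# AT EVERY TRUNCATION AND THE b9 EDGE AT EVERY LEVEL — lit ✓`B8SockHFPTraceFree.sockHFP(₀)_body_of_join_RD_traceFree` + a `G`-form twin of lit ✓`B8Prop5KLevelLetters.hP5_step_of_HFP`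

Route `UnitScaleTilt`, crux K1 child «MinimiserStabilityRegPr» (stmt-QuantumFields-19200), registered stub `stub_halvingStep` (`BirthV10`).  Cell `ym3-torus` (HUMAN RULING
D-0037: YM₃ on T³ is ladder rung R3 — NOT d = 4, NOT a mass gap, NOT the Clay problem), width seat `ym-ust-19200-w3` gen 9.  `--supports stmt-QuantumFields-19200 --as helper`;
THEOREMS ONLY (0 `def`, 0 `sorry`); count-neutral; nothing here claims `hT4T`, `hMember`, `hSupUρ4`, the stub, the crux or the gap.

WHY.  After K-final v2 (✓p673445) the step display of H reads `hT4TL ∧ SB9L ∧ SLetτL ∧ H59TL`; `hT4TL` is [Balaban1985RegularSpaces] Theorem 4's datum, kernel-reducible to the three RAW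
sockets `hP5base hP5 H59raw` of ✓p654692 by ✓p667955 §2 `hT4T_of_rawSockets`.  Proposition 5's existence half is PROVED in lit modulo the [4] letters: the JOIN
✓`B8SockHFPRD.sockHFP_of_sockLettersRD` and its `τ`-free twin ✓`B8SockHFPTraceFree.sockHFP(₀)_body_of_join_RD_traceFree`.  THIS FILE runs that twin at N05's cube member of record
`(Ω, Λs, Λb) := (cubeFam false L a M ρ k, cubeLamS …, cubeLamB …)` at the FLAT background (`U₀ := 1 ∈ G`), for the pre-gauged field `U′` of J3 (rows (1.34)-𝔄 on `ℤᵈ`, axial at `1` for every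
family, tower row (d)), and converts the `τ`-free ∃λ-bodies into the raw sockets' `G`-form ∃(v, λ)-bodies (`v := e^{iλ} ∈ G` by the group law (G3) `hG3`).
* §1 ★ `hP5_step_mem_of_HFP` — lit ✓`hP5_step_of_HFP` VERBATIM with `v := e^{iλ}` KEPT `G`-valued (`hvG`); Landau (1.38) at `m + 1` by lit
  ✓`isLandau138W_gaugeFixed_of_multiplier`, locality by ✓`isLandau138W_congr`.
* §2 ★★ `rawP5_of_lettersτ_cubeMember` — the raw STEP socket `hP5` of ✓p654692 (levels `1 ≤ m < k`, `G`-form, `α₄ := 8B₀′c⋆`) from: the [4] letters at truncation `m + 1` with their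
  sixteen laws and three `τ`-laws (lit `SockLettersRD`'s body at `(α₀, U₀ := 1, m + 1)` ∧ lit `LettersTau`'s fields — the shape of ✓p654110's `SLetτ`), FOR EVERY `m < k`; the b9 edge
  lit `SockB9P3` at every level `m ≤ k`; the JOIN's scalar windows as ONE conjunction `hwin` (letter for letter lit ✓`B8SockHFPWindows.hfpWindows_of_guard`'s conclusion = lit
  ✓`B8SockHFPTorusTraceFree.sockHFPτ_family_of_lettersAt`'s `hwin`).  Member laws by lit ✓`hΩ_cubeFam`∕`hbox_cubeLamB`∕`hclass_cubeLamB`∕`htw_cubeLamS`∕`h8lt_cubeLamS`∕`h8top_cubeLamS`,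
  J3's rows → `h34 hAx h135` by ✓`h34_of_inAk_univ`∕`hAx_of_inAx_one`∕`h135_cubeMember` (✓p647600), the datum's exponent `τ`-free by lit ✓`apply_eq_zero_of_cfgExp_mem` (`U₁ ∈ G`).
* (FILE A′ ✓`HalvingHSiteRawP5BaseOfLeaf`) ★★ `rawP5base_of_lettersτ_cubeMember` — the raw BASE socket `hP5base` (level `0 → 1`) by the same device at truncation `1`.
HONEST SCOPE.  By-name plumbing over landed lit theorems; the [4] letters (Thm 3.1 ∕ (3.25)), the b9 edge (Thm 3.3 in Prop. 3's frame) and the windows are DISPLAYED hypotheses; nothing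
of [4], Prop. 3, Theorem 4 or the stub is proved here.  Rung R3 (YM₃ on T³), NOT Clay; YM gap NOT proved.

References: T. Bałaban, CMP **99** (1985) 75–102 [Balaban1985RegularSpaces] (Prop. 5 (1.106)–(1.109) p.94, Thm 4 p.88, (1.66)–(1.69) pp.87–88, (1.29) p.81, (1.38) p.82,
(1.131) p.99, p.76 «G = SU(N)»); CMP **99** (1985) 389–434 [Balaban1985BackgroundPropagators] (Thm 3.1 p.397, (3.25) p.394, Thm 3.3 p.398); CMP **98** (1985) 17–51
[Balaban1985Averaging] ((43) p.24).
-/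

set_option autoImplicit false

noncomputable section

open scoped BigOperators
open NormedSpace
open Complex (I)

namespace Summit.QuantumFields.YangMills.Theorems.HalvingHSiteRawP5OfLeaf

open Literature.MathematicalPhysics.QuantumFieldTheory.Balaban1983to89
open MatrixLog (mlog)
open B7Prop1Explicit (e expUnit U1 Site)
open B7Prop2Explicit (unitaryUnits unitaryUnits_le_U1 C0 c2' avgIter AvgClosed)
open B7Prop3Flat (c3)
open B7Prop10General (C6 C4G)
open B7Prop9Flat (C5')
open B7Prop1Local (InBox loK bondHiK)
open B7Eq78Linearization (conjR zdBlocking QprimeIter)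
open B7Eq92Concrete (mgauge mgauge_apply Rc Rc_apply)
open B8Ineq130 (tlo thi)
open B8Ineq132 (covDerivFwd covDeriv InAk BondTouches)
open B8Eq119TwistedAxial (Restr129 InAx bgT)
open B8Eq184Proof (gaugeExp cfgExp)
open B8Eq182Proof (gAd)
open B8Eq188Proof (frakF3)
open B8Lemma1NonAbelian (mulCfg)
open B8Eq140Level (SideTouches)
open B8Eq138LandauZd (IsLandau138W covDivB covLap QT isLandau138W_congr)
open B8Ineq125Concrete (C2p)
open B8Eq1117Concrete (XSpace)
open B8LeafModelZd3 (SockB9P3)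
open B8Prop5ContractionKLevel (Bd2 Mc Kc)
open B8LambdaSpaceKLevel (wt)
open B8Prop5KLevelLetters (isLandau138W_gaugeFixed_of_multiplier)
open B8Prop6OfThm4 (one_inAk)
open B8Eq131Cubes (tLo tHi collar_cube)
open B8Eq131CubesAdmissible (cubeFam cubeFam_false_of_le)
open B8CubeMemberZd (cubeLamS cubeLamB hΩ_cubeFam hbox_cubeLamB hclass_cubeLamB)
open B8SockHFPCubeMember (htw_cubeLamS h8lt_cubeLamS h8top_cubeLamS)
open B8SockHFPTraceFree (sockHFP_body_of_join_RD_traceFree sockHFP₀_body_of_join_RD_traceFree)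
open B8SockHFPTorusTraceFree (apply_eq_zero_of_cfgExp_mem)
open B8Thm4TruncationLocal (base_datum)
open HalvingP1FlatCoreSupplierInduction (h34_of_inAk_univ hAx_of_inAx_one h135_cubeMember ends_of_sideTouches)

variable {d : ℕ} {𝔸 : Type*} [CStarAlgebra 𝔸] [Nontrivial 𝔸]

/-! ## §1 The `G`-form Proposition-5 step adapter: plain-currency fixed point with `e^{iλ} ∈ G` ⇒ the raw socket's ∃(v, λ)-body -/

/-- ★ **THE PROP.-5 STEP IN PLAIN CURRENCY ⇒ THE RAW SOCKET's `G`-FORM BODY** — lit ✓`B8Prop5KLevelLetters.hP5_step_of_HFP` VERBATIM (one level, any `m`; `v := e^{iλ}` unitary,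
reads `e^{iλ}` on every bond, obeys (1.108); `U₁^{v⁻¹}` satisfies the Landau condition of record (1.38) at `m + 1` levels by lit ✓`isLandau138W_gaugeFixed_of_multiplier` transported
from `e^{iηA}` to `U₁` by locality; (1.29) for `u₁·v` carried) with the fixed point's `λ` displayed and ONE more input `hvG : ∀ x, e^{iλ(x)} ∈ G` (for `G = SU(N)`: `λ` Hermitian and
trace-free, lit ✓`B8SpecialUnitaryTrace.gaugeExp_mem_specialUnitaryUnits`), so that the conclusion carries `∀ x, v x ∈ G` in place of «unitary, `= 1` off `Ω₀`».
[cite: Balaban1985RegularSpaces, Prop. 5 pp.93–94, (1.107)–(1.110) p.94, (1.86)–(1.88) p.91, (1.38) p.82, p.76] -/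
theorem hP5_step_mem_of_HFP (hd2 : 2 ≤ d) {η : ℝ} (hη : 0 < η) (L m : ℕ) (G : Subgroup 𝔸ˣ) {U₀ : Site d → Fin d → 𝔸ˣ}
    (hU₀ : ∀ x κ, U₀ x κ ∈ unitaryUnits 𝔸) {cstar α₄ : ℝ} (hs₁ : α₄ ≤ 1 / 84) (hcs : cstar ≤ 1 / 12)
    (Ω : ℕ → Set (Site d)) (Λs : ℕ → ℕ → Set (Site d)) (u₁ : Site d → 𝔸ˣ) (U₁ : Site d → Fin d → 𝔸ˣ) (A : Site d → Fin d → 𝔸)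
    (hdat : ∀ j, j ≤ m → ∀ b ∈ {b : Site d × Fin d | SideTouches (Ω j) b.1 b.2},
      U₁ b.1 b.2 = cfgExp η A b.1 b.2 ∧ IsSelfAdjoint (A b.1 b.2) ∧ ‖A b.1 b.2‖ ≤ cstar * ((L : ℝ) ^ j * η)⁻¹)
    (lam : Site d → 𝔸) (hvG : ∀ x, gaugeExp lam x ∈ G)
    (h108 : ∀ j, j ≤ m + 1 → ∀ b ∈ {b : Site d × Fin d | SideTouches (Ω j) b.1 b.2},
      ‖lam b.1‖ ≤ α₄ ∧ ((L : ℝ) ^ j * η) * ‖covDerivFwd η U₀ b.2 lam b.1‖ ≤ α₄)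
    (hmult : ∃ μ : ℕ → Site d → 𝔸, ∀ x ∈ Ω 0,
      covLap η U₀ ((Ω 0).indicator fun y => covDivB η U₀ A y + covLap η U₀ lam y +
        ((conjR (gaugeExp lam y)⁻¹ (covDivB η U₀ A y) - covDivB η U₀ A y) +
          (gAd (covLap η U₀ lam y) (lam y) - covLap η U₀ lam y) + ∑ μ, frakF3 η U₀ lam A y μ)) x =
        QT L (m + 1) (Λs (m + 1)) U₀ μ x)
    (h129 : Restr129 L (m + 1) (Λs (m + 1)) U₀ (u₁ * gaugeExp lam)) :
    ∃ (v : Site d → 𝔸ˣ) (lam : Site d → 𝔸), (∀ x, v x ∈ G) ∧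
      (∀ j, j ≤ m + 1 → ∀ b ∈ {b : Site d × Fin d | SideTouches (Ω j) b.1 b.2}, (v b.1 : 𝔸) = ((gaugeExp lam b.1 : 𝔸ˣ) : 𝔸) ∧
        (v (b.1 + e b.2) : 𝔸) = ((gaugeExp lam (b.1 + e b.2) : 𝔸ˣ) : 𝔸)) ∧
      (∀ j, j ≤ m + 1 → ∀ b ∈ {b : Site d × Fin d | SideTouches (Ω j) b.1 b.2},
        ‖lam b.1‖ ≤ α₄ ∧ ((L : ℝ) ^ j * η) * ‖covDerivFwd η U₀ b.2 lam b.1‖ ≤ α₄) ∧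
      IsLandau138W L (m + 1) η (Ω 0) (Λs (m + 1)) U₀ (mgauge U₀ v⁻¹ U₁) ∧ Restr129 L (m + 1) (Λs (m + 1)) U₀ (u₁ * v) := by
  have hE0 : ∀ {y : Site d} {τ : Fin d}, BondTouches (Ω 0) y τ → (y, τ) ∈ {b : Site d × Fin d | SideTouches (Ω 0) b.1 b.2} :=
    fun hb => B8Prop5ExistsZdLan.sideTouches_of_bondTouches_two hd2 hb
  have hα12 : α₄ ≤ 1 / 12 := hs₁.trans (by norm_num)
  have hα70 : α₄ ≤ 1 / 70 := hs₁.trans (by norm_num)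
  have hd1 : 0 < d := by omega
  -- (1.108) at level `j = 0` on the bonds touching `Ω₀`
  have h0 : ∀ y τ, BondTouches (Ω 0) y τ → ‖lam y‖ ≤ α₄ ∧ η * ‖covDerivFwd η U₀ τ lam y‖ ≤ α₄ := fun y τ hb => by
    simpa only [pow_zero, one_mul] using h108 0 (Nat.zero_le _) (y, τ) (hE0 hb)
  have hl : ∀ x ∈ Ω 0, ‖lam x‖ ≤ 1 / 12 := fun x hx => (h0 x ⟨0, hd1⟩ (Or.inl hx)).1.trans hα12
  have hD : ∀ x ∈ Ω 0, ∀ μ, η * ‖covDerivFwd η U₀ μ lam x‖ ≤ 1 / 70 := fun x hx μ => (h0 x μ (Or.inl hx)).2.trans hα70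
  have hback : ∀ x ∈ Ω 0, ∀ μ : Fin d, BondTouches (Ω 0) (x - e μ) μ := fun x hx μ => Or.inr (by rwa [sub_add_cancel])
  have ha : ∀ x ∈ Ω 0, ∀ μ, η * ‖covDeriv η U₀ μ lam x‖ ≤ 1 / 70 := fun x hx μ => by
    rw [B8Eq151V2Divergence.norm_covDeriv_eq (unitaryUnits_le_U1 (hU₀ _ _)) lam]
    exact (h0 _ μ (hback x hx μ)).2.trans hα70
  have hY : ∀ x ∈ Ω 0, ∀ μ, η * ‖conjR (U₀ (x - e μ) μ)⁻¹ (A (x - e μ) μ)‖ ≤ 1 / 12 := fun x hx μ => by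
    obtain ⟨-, -, hA⟩ := hdat 0 (Nat.zero_le _) (x - e μ, μ) (hE0 (hback x hx μ))
    rw [B8Ineq132.norm_conjR ((U1 𝔸).inv_mem (unitaryUnits_le_U1 (hU₀ _ _)))]
    rw [pow_zero, one_mul] at hA
    calc η * ‖A (x - e μ) μ‖ ≤ η * (cstar * η⁻¹) := mul_le_mul_of_nonneg_left hA hη.le
      _ = cstar := by rw [mul_left_comm, mul_inv_cancel₀ hη.ne', mul_one]
      _ ≤ 1 / 12 := hcs
  have hLan : IsLandau138W L (m + 1) η (Ω 0) (Λs (m + 1)) U₀ (mgauge U₀ (gaugeExp lam)⁻¹ (cfgExp η A)) :=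
    isLandau138W_gaugeFixed_of_multiplier hη L (m + 1) (Ω 0) (Λs (m + 1)) U₀ A hl hD ha hY hmult
  have hcongr : ∀ (x : Site d) (μ : Fin d), BondTouches (Ω 0) x μ →
      mgauge U₀ (gaugeExp lam)⁻¹ U₁ x μ = mgauge U₀ (gaugeExp lam)⁻¹ (cfgExp η A) x μ := fun x μ hb => by
    rw [mgauge_apply, mgauge_apply, (hdat 0 (Nat.zero_le _) (x, μ) (hE0 hb)).1]
  exact ⟨gaugeExp lam, lam, hvG, fun j _ b _ => ⟨rfl, rfl⟩, h108, (isLandau138W_congr η L U₀ hcongr).mpr hLan, h129⟩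

/-! ## §2 The raw STEP socket `hP5` (levels `1 ≤ m < k`) at N05's cube member, flat background, from the letters at truncation `m + 1` + the b9 edge at level `m` -/

set_option maxHeartbeats 400000 in
/-- ★★ **THE RAW PROPOSITION-5 STEP SOCKET `hP5` OF ✓p654692 IN `G`-FORM, AT N05's CUBE MEMBER OF RECORD AND THE FLAT BACKGROUND, FROM THE [4] LETTERS + THE b9 EDGE** —
for every level `1 ≤ m < k` and every `G`-valued level-`m` datum `(u₁, U₁, A)` of Theorem 4's induction (`U₁^{u₁} = U′`, (1.29) at `m`, Landau (1.38) at `m`, chart `U₁ = e^{iηA}` with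
`|A| ≤ c⋆(Lʲη)⁻¹` on the touched sides): `∃ (v, λ)`, `v` `G`-valued, `v = e^{iλ}` on the touched sides, (1.108) at `α₄ = 8B₀′c⋆`, Landau (1.38) at `m + 1` for `U₁^{v⁻¹}`, (1.29) at
`m + 1` for `u₁v` — lit ✓`B8SockHFPTraceFree.sockHFP_body_of_join_RD_traceFree` at `(cubeFam false, cubeLamS, cubeLamB)`, `U₀ := 1` (member laws lit ✓`hΩ_cubeFam` ∕ `hbox_cubeLamB` ∕
`hclass_cubeLamB` ∕ `htw_cubeLamS` ∕ `h8lt_cubeLamS` ∕ `h8top_cubeLamS`; J3's rows ↦ `h33 h34 hAx h135` by lit ✓`one_inAk`, ✓`h34_of_inAk_univ`, ✓`hAx_of_inAx_one`, ✓`h135_cubeMember`;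
the datum's exponent `τ`-free because `e^{iηA} = U₁ = u₁⁻¹·U′·u₁(· + e)` is `G ≤ H`-valued within `⅛` of `1`, lit ✓`apply_eq_zero_of_cfgExp_mem`), then §1 `hP5_step_mem_of_HFP` with (G3).
[cite: Balaban1985RegularSpaces, Prop. 5 (1.106)–(1.109) p.94, Thm 4 p.88, (1.67)–(1.69) p.88, (1.131) p.99, p.76; Balaban1985BackgroundPropagators, Thm 3.1 p.397, (3.25) p.394, Thm 3.3 p.398] -/
theorem rawP5_of_lettersτ_cubeMember (τ : 𝔸 →L[ℂ] ℂ) (hτ : ∀ x y : 𝔸, τ (x * y) = τ (y * x)) (hd2 : 2 ≤ d) {L : ℕ} (hL : 2 ≤ L) {η : ℝ} (hη : 0 < η)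
    {k : ℕ}
    -- the groups of the joint J-SU: `G` (averaging-closed, unitary; `1, U′, u₁ ∈ G`) `≤ H` ((H2), (H3)), and (G3) `e^{iλ} ∈ G` for Hermitian `τ`-free `λ`
    -- (at `M₂(ℂ)`: `SU(2) ≤ SL(2, ℂ)` by lit ✓`B8SpecialLinearTrace`, (G3) by lit ✓`B8SpecialUnitaryTrace.gaugeExp_mem_specialUnitaryUnits`)
    {G H : Subgroup 𝔸ˣ} (hGrp2 : ∀ g ∈ H, ‖(g : 𝔸) - 1‖ ≤ 1 / 8 → τ (mlog (g : 𝔸)) = 0) (hGrp3 : ∀ S : 𝔸, τ S = 0 → expUnit S ∈ H)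
    (hGA : AvgClosed d L G) (hGH : G ≤ H) (hGu : G ≤ unitaryUnits 𝔸)
    (hG3 : ∀ lam : Site d → 𝔸, (∀ x, IsSelfAdjoint (lam x)) → (∀ x, τ (lam x) = 0) → ∀ x, gaugeExp lam x ∈ G)
    -- N05's cube member OF RECORD `Ω_j := □_j = cubeFam false L a M ρ k j` with its tower families (lit `B8CubeMemberZd`; defining equations, callers write `rfl`)
    (aC : Site d) (M : ℕ) {ρ : ℕ} (hρ : L ≤ ρ)
    {Ω : ℕ → Set (Site d)} (hΩdef : Ω = cubeFam false L aC M ρ k)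
    {Λs : ℕ → ℕ → Set (Site d)} (hΛsdef : Λs = cubeLamS L aC M ρ k)
    {Λb : ℕ → ℕ → Set (Site d × Fin d)} (hΛbdef : Λb = cubeLamB L aC M ρ k)
    -- the constants and the pre-gauged field `U′` of J3 (`G`-valued), with J3's three rows: (1.34)-𝔄 on `ℤᵈ`, axial at the flat background for every family, the tower row (d)
    {α₀ α₁ B₀ B₀' : ℝ} (hα₀ : 0 < α₀) (hα₁ : 0 < α₁) (hB₀ : 0 < B₀) (hB₀' : 0 < B₀')
    {U' : Site d → Fin d → 𝔸ˣ} (hU'G : ∀ x κ, U' x κ ∈ G)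
    (hInAk : InAk L k η α₀ (fun _ => (Set.univ : Set (Site d))) U')
    (hAxJ : ∀ m', m' ≤ k → ∀ Λ : ℕ → Set (Site d), InAx L m' Λ (1 : Site d → Fin d → 𝔸ˣ) U')
    (htw : ∀ m', m' ≤ k → ∀ (x : Site d) (ν : Fin d), tlo L (tLo aC ρ) m' ≤ x → x + e ν ≤ thi L (tHi aC M ρ) m' →
      ‖((avgIter L U' (k - m') x ν : 𝔸ˣ) : 𝔸) - 1‖ < α₁)
    -- the b9 edge in Prop. 3's frame AT EVERY LEVEL `m ≤ k` (lit `SockB9P3`; [4] Thm 3.3 — N06), with its threshold `cB9`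
    {B₀β cB9 β : ℝ}
    (SB9all : ∀ m, m ≤ k → ∃ len : Site d → ℝ, SockB9P3 (𝔸 := 𝔸) L B₀ B₀β cB9 β len η m Ω Λs Λb)
    -- the [4] LETTERS AT EVERY TRUNCATION `n ≤ k` AT THE FLAT BACKGROUND, AS ONE ∃-PACKAGE PER `n`: lit `SockLettersRD`'s body at `(α₀, U₀ := 1, n)` ∧ lit `LettersTau`'s three
    -- fields (the shape of ✓p654110's `SLetτ`, there at `n := m + 1` only) — [4] Thm 3.1 ∕ (3.25) for Bałaban's operators `G Δ Q Q* A C H′` on the member's cube families (N05∕N06)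
    {B₀'H B₂' BG BR : ℝ} (hB₀'H : 0 < B₀'H) (hB₂' : 0 ≤ B₂') (hBG : 0 ≤ BG) (hBR : 0 ≤ BR)
    (SLetτ : ∀ n, 1 ≤ n → n ≤ k → ∃ (g Δ : (Site d → 𝔸) →ₗ[ℂ] (Site d → 𝔸)) (q : (Site d → 𝔸) →ₗ[ℂ] (ℕ → Site d → 𝔸))
        (qs : (ℕ → Site d → 𝔸) →ₗ[ℂ] (Site d → 𝔸)) (Aw c : (ℕ → Site d → 𝔸) →ₗ[ℂ] (ℕ → Site d → 𝔸)) (H' : XSpace d n 𝔸 →ₗ[ℂ] (Site d → 𝔸)),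
      (∀ x, ∀ y ∈ Ω 0, (Δ (g x) + qs (Aw (q (g x)))) y = x y) ∧ (∀ f, q (g (g (qs (c (q f))))) = q f) ∧
      (∀ (f : Site d → 𝔸), ∀ x ∈ Ω 0, Δ f x = covLap η (1 : Site d → Fin d → 𝔸ˣ) ((Ω 0).indicator f) x) ∧
      (∀ (μ : ℕ → Site d → 𝔸), ∀ x ∈ Ω 0, qs μ x = QT L n (Λs n) (1 : Site d → Fin d → 𝔸ˣ) μ x) ∧
      (∀ (f : Site d → 𝔸) (j : ℕ), j ≤ n → ∀ y ∈ Λs n j, q f j y = QprimeIter (zdBlocking d L) (bgT L (1 : Site d → Fin d → 𝔸ˣ)) j f y) ∧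
      (∀ (X : XSpace d n 𝔸) (x : Site d), ‖H' X x‖ ≤ B₀'H * ‖X‖) ∧
      (∀ j, j ≤ n → ∀ (X : XSpace d n 𝔸), ∀ p ∈ {b : Site d × Fin d | SideTouches (Ω j) b.1 b.2},
        wt L η j * ‖covDerivFwd η (1 : Site d → Fin d → 𝔸ˣ) p.2 (H' X) p.1‖ ≤ B₀'H * ‖X‖) ∧
      (∀ X : XSpace d n 𝔸, Bd2 L η n Ω (covLap η (1 : Site d → Fin d → 𝔸ˣ) (H' X)) (B₂' * ‖X‖)) ∧
      (∀ (X : XSpace d n 𝔸) (x : Site d), x ∉ Ω 0 → H' X x = 0) ∧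
      (∀ X Y : XSpace d n 𝔸, (∀ p, Y p = -star (X p)) → ∀ x, H' Y x = -star (H' X x)) ∧
      (∀ (Y : XSpace d n 𝔸) (j : ℕ) (hj : j ≤ n) (y : Site d), y ∈ Λs n j →
        QprimeIter (zdBlocking d L) (bgT L (1 : Site d → Fin d → 𝔸ˣ)) j (H' Y) y = Y (⟨j, Nat.lt_succ_of_le hj⟩, y)) ∧
      (∀ (f : Site d → 𝔸) (r : ℝ), 0 ≤ r → Bd2 L η n Ω f r →
        (∀ x, ‖g f x‖ ≤ BG * r) ∧ ∀ j, j ≤ n → ∀ p ∈ {b : Site d × Fin d | SideTouches (Ω j) b.1 b.2},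
          wt L η j * ‖covDerivFwd η (1 : Site d → Fin d → 𝔸ˣ) p.2 (g f) p.1‖ ≤ BG * r) ∧
      (∀ (f : Site d → 𝔸) (x : Site d), x ∉ Ω 0 → g f x = 0) ∧
      (∀ f : Site d → 𝔸, (∀ j, j ≤ n → ∀ x ∈ Ω j, IsSelfAdjoint (f x)) → ∀ x, IsSelfAdjoint (g f x)) ∧
      (∀ (f : Site d → 𝔸) (r : ℝ), 0 ≤ r → Bd2 L η n Ω f r → Bd2 L η n Ω (f - g (qs (c (q (g f))))) (BR * r)) ∧
      (∀ f : Site d → 𝔸, (∀ j, j ≤ n → ∀ x ∈ Ω j, IsSelfAdjoint (f x)) → ∀ j, j ≤ n → ∀ x ∈ Ω j, IsSelfAdjoint ((f - g (qs (c (q (g f))))) x)) ∧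
      (∀ X : XSpace d n 𝔸, (∀ p, τ (X p) = 0) → ∀ x, τ (H' X x) = 0) ∧
      (∀ f : Site d → 𝔸, (∀ j, j ≤ n → ∀ x ∈ Ω j, τ (f x) = 0) → ∀ x, τ (g f x) = 0) ∧
      (∀ f : Site d → 𝔸, (∀ j, j ≤ n → ∀ x ∈ Ω j, τ (f x) = 0) → ∀ j, j ≤ n → ∀ x ∈ Ω j, τ ((f - g (qs (c (q (g f))))) x) = 0))
    -- the JOIN's scalar windows at this `(α₀, α₁)` AS ONE CONJUNCTION — letter for letter the conclusion of lit ✓`B8SockHFPWindows.hfpWindows_of_guard` (= the `hwin` of lit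
    -- ✓`B8SockHFPTorusTraceFree.sockHFPτ_family_of_lettersAt`): Prop. 3's four, the b9 thresholds, the Sect. D∕E JOIN's, at `c⋆ = 5dLB₀(α₀ + α₁)`, `α₄ = 8B₀′c⋆`, `cB = cA = L·c⋆`, `cDA = 2dL²·c⋆`
    (hwin : ∀ cs α₄ cB cDA hE hE₂ lE lE₂ : ℝ, cs = 5 * (d : ℝ) * L * B₀ * (α₀ + α₁) → α₄ = 8 * B₀' * (5 * (d : ℝ) * L * B₀) * (α₀ + α₁) →
      cB = L * cs → cDA = 2 * (d : ℝ) * (L : ℝ) ^ 2 * cs →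
      hE = B₀'H * (C2p d * (40 * d * cB + α₄) * α₄) → hE₂ = B₂' * (C2p d * (40 * d * cB + α₄) * α₄) →
      lE = B₀'H * (4 * C2p d * (40 * d * cB + 2 * α₄)) → lE₂ = B₂' * (4 * C2p d * (40 * d * cB + 2 * α₄)) →
      36 * d * B₀ * cs ≤ 1 / 2 ∧
      8 * (131072 * ((d : ℝ) + 1) ^ 2) * Real.exp (4 * (800 * ((d : ℝ) + 1) ^ 2 * ((d : ℝ) + 4)) * α₀) ≤ 16 * (131072 * ((d : ℝ) + 1) ^ 2) ∧
      2 * cs ^ 2 + 20 * d * α₀ * cs + 2 * (16 * (131072 * ((d : ℝ) + 1) ^ 2)) * cs ^ 2 ≤ α₀ + α₁ ∧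
      (d : ℝ) * L * α₁ ≤ 1 / 8 ∧
      α₀ ≤ cB9 ∧ cs ≤ cB9 ∧
      C0 d * α₀ ≤ 1 / 3 ∧ 4 * α₀ ≤ c2' d L ∧
      Real.exp (4 * (800 * ((d : ℝ) + 1) ^ 2 * ((d : ℝ) + 4)) * α₀) * (1 + 8 * (131072 * ((d : ℝ) + 1) ^ 2) * cB) ≤ 2 ∧
      2 * cB ≤ c3 d L ∧ 2048 * (d : ℝ) * cB ≤ 1 ∧ 40 * d * cB ≤ 1 / 200 ∧
      200 * C6 d * (2 * α₄) ≤ 1 ∧ 12000 * ((d : ℝ) + 1) * L * (2 * α₄) ≤ 1 ∧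
      C4G d L * (α₀ + 40 * d * cB + 4 * (2 * α₄)) ≤ 1 ∧
      1024 * ((d : ℝ) + 1) * ((d : ℝ) + 4) * L ^ 2 * α₀ ≤ 1 ∧ 32 * ((d : ℝ) + 1) ^ 2 * C6 d * L ^ 2 * α₀ ≤ 1 ∧
      16 * d * C5' d * C6 d * (L : ℝ) ^ 2 * α₀ ≤ 1 ∧ 8 * d * C6 d * L * α₀ ≤ 1 ∧
      40 * d * cB + α₄ ≤ 1 / (4 * B₀'H * (2 * C2p d)) ∧ 2 * C6 d * (40 * d * cB + 4 * α₄) ≤ 1 / 8 ∧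
      cB ≤ 1 / 13 ∧ α₄ / 4 + hE ≤ 1 / 24 ∧ α₄ / 4 + hE ≤ 1 / 140 ∧ 10 * (α₄ / 4 + hE) * BR ≤ 1 / 2 ∧
      BG * Mc d BR (α₄ / 4 + hE) cB hE₂ cDA ≤ α₄ / 4 ∧
      BG * Kc d BR (α₄ / 4 + hE) cB hE₂ cDA lE₂ (1 + lE) (1 + lE) ≤ 1 / 2) :
    ∀ m, 1 ≤ m → m < k → ∀ (u₁ : Site d → 𝔸ˣ) (U₁ : Site d → Fin d → 𝔸ˣ) (A : Site d → Fin d → 𝔸),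
      (∀ x, u₁ x ∈ G) → mgauge (1 : Site d → Fin d → 𝔸ˣ) u₁ U₁ = U' → Restr129 L m (Λs m) (1 : Site d → Fin d → 𝔸ˣ) u₁ →
      IsLandau138W L m η (Ω 0) (Λs m) (1 : Site d → Fin d → 𝔸ˣ) U₁ →
      (∀ j, j ≤ m → ∀ b ∈ {b : Site d × Fin d | SideTouches (Ω j) b.1 b.2},
        U₁ b.1 b.2 = cfgExp η A b.1 b.2 ∧ IsSelfAdjoint (A b.1 b.2) ∧ ‖A b.1 b.2‖ ≤ (5 * (d : ℝ) * L * B₀ * (α₀ + α₁)) * ((L : ℝ) ^ j * η)⁻¹) →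
      ∃ (v : Site d → 𝔸ˣ) (lam : Site d → 𝔸), (∀ x, v x ∈ G) ∧
        (∀ j, j ≤ m + 1 → ∀ b ∈ {b : Site d × Fin d | SideTouches (Ω j) b.1 b.2}, (v b.1 : 𝔸) = ((gaugeExp lam b.1 : 𝔸ˣ) : 𝔸) ∧
          (v (b.1 + e b.2) : 𝔸) = ((gaugeExp lam (b.1 + e b.2) : 𝔸ˣ) : 𝔸)) ∧
        (∀ j, j ≤ m + 1 → ∀ b ∈ {b : Site d × Fin d | SideTouches (Ω j) b.1 b.2},
          ‖lam b.1‖ ≤ 8 * B₀' * (5 * (d : ℝ) * L * B₀) * (α₀ + α₁) ∧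
            ((L : ℝ) ^ j * η) * ‖covDerivFwd η (1 : Site d → Fin d → 𝔸ˣ) b.2 lam b.1‖ ≤ 8 * B₀' * (5 * (d : ℝ) * L * B₀) * (α₀ + α₁)) ∧
        IsLandau138W L (m + 1) η (Ω 0) (Λs (m + 1)) (1 : Site d → Fin d → 𝔸ˣ) (mgauge (1 : Site d → Fin d → 𝔸ˣ) v⁻¹ U₁) ∧
        Restr129 L (m + 1) (Λs (m + 1)) (1 : Site d → Fin d → 𝔸ˣ) (u₁ * v) := by
  intro m hm1 hmk u₁ U₁ A hu₁G hW h129 hLan hdat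
  subst hΩdef hΛsdef hΛbdef
  have hL1 : 1 ≤ L := le_trans (by norm_num) hL
  have hLr : (1 : ℝ) ≤ L := by exact_mod_cast hL1
  have hρ1 : 1 ≤ ρ := hL1.trans hρ
  have hmK : m + 1 ≤ k := hmk
  -- the windows at this `(α₀, α₁)`
  obtain ⟨hside, hC₂, h61, hsmall₁, hα₀9, hcs9, hα3, hα4, hsmall, hc₃, hsc, hα₃', hs₁, hs₂, hs₃, hs₄, hs₅, hs₆, hs₇, hsm, hprod8, hcA', ha₁',
    hb₁', hθ, h103, h106⟩ := hwin _ _ _ _ _ _ _ _ rfl rfl rfl rfl rfl rfl rfl rfl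
  have hcs0 : 0 ≤ 5 * (d : ℝ) * L * B₀ * (α₀ + α₁) := by
    have : 0 ≤ α₀ + α₁ := by linarith
    positivity
  have hcDAlo : (d : ℝ) * (L : ℝ) ^ 2 * (5 * (d : ℝ) * L * B₀ * (α₀ + α₁)) ≤ 2 * (d : ℝ) * (L : ℝ) ^ 2 * (5 * (d : ℝ) * L * B₀ * (α₀ + α₁)) := by
    have h := mul_nonneg (by positivity : (0 : ℝ) ≤ (d : ℝ) * (L : ℝ) ^ 2) hcs0
    linarith only [h]
  -- `c⋆ ≤ 1∕8000` (hence `16c⋆ ≤ 1`, `c⋆ ≤ 1∕12`) and `α₄ ≤ 1∕84` from the JOIN's windows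
  have h16 : 16 * (5 * (d : ℝ) * L * B₀ * (α₀ + α₁)) ≤ 1 := by
    have hd0 : (1 : ℝ) ≤ d := by exact_mod_cast (show 1 ≤ d by omega)
    have hcsB : 5 * (d : ℝ) * L * B₀ * (α₀ + α₁) ≤ L * (5 * (d : ℝ) * L * B₀ * (α₀ + α₁)) := le_mul_of_one_le_left hcs0 hLr
    have hcBsmall : (d : ℝ) * (L * (5 * (d : ℝ) * L * B₀ * (α₀ + α₁))) ≤ 1 / 8000 := by linarith only [hα₃']
    have h1 : 5 * (d : ℝ) * L * B₀ * (α₀ + α₁) ≤ 1 / 8000 :=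
      ((le_mul_of_one_le_left hcs0 hd0).trans (mul_le_mul_of_nonneg_left hcsB (by positivity))).trans hcBsmall
    linarith only [h1]
  have hcs12 : 5 * (d : ℝ) * L * B₀ * (α₀ + α₁) ≤ 1 / 12 := by linarith only [h16, hcs0]
  have hα84 : 8 * B₀' * (5 * (d : ℝ) * L * B₀) * (α₀ + α₁) ≤ 1 / 84 := by
    have hC6 : (2 : ℝ) ≤ C6 d := B7ConclGaugeLin.two_le_C6'
    have hα₄0 : 0 ≤ 8 * B₀' * (5 * (d : ℝ) * L * B₀) * (α₀ + α₁) := by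
      have : 0 ≤ α₀ + α₁ := by linarith
      positivity
    have h := mul_le_mul_of_nonneg_right hC6 (by positivity : (0 : ℝ) ≤ 200 * (2 * (8 * B₀' * (5 * (d : ℝ) * L * B₀) * (α₀ + α₁))))
    nlinarith only [hs₁, h, hα₄0]
  -- the member geometry (lit `B8CubeMemberZd` ∕ `B8SockHFPCubeMember`, BY NAME)
  have hΩ := hΩ_cubeFam (d := d) hL1 aC M hρ k
  have hbox := hbox_cubeLamB (d := d) L aC M ρ k
  have hclass := hclass_cubeLamB (d := d) L aC M ρ k
  have htower := htw_cubeLamS (d := d) hL1 aC M ρ k (m + 1) hmK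
  have hlt := h8lt_cubeLamS (d := d) L aC M ρ k m hmk
  have htop := h8top_cubeLamS (d := d) hL1 aC M ρ k m hmk
  -- the pre-gauged field's rows at the flat background: (1.33) of `1`, (1.34)∕(Ax)∕(1.35) from J3's currency (✓p647600 §1)
  have h33 : InAk L k η α₀ (cubeFam false L aC M ρ k) (1 : Site d → Fin d → 𝔸ˣ) := one_inAk hL1 k hη hα₀ _
  have h34 := h34_of_inAk_univ hInAk (cubeFam false L aC M ρ k)
  have hAx := hAx_of_inAx_one hAxJ (cubeLamS L aC M ρ k)
  have h135 := h135_cubeMember (𝔸 := 𝔸) hL aC M hρ1 htw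
  -- group data: `1, U′ ∈ G`; `u₁ ∈ G ≤ H ≤ U(𝔸)`; `U₁ = u₁⁻¹·U′·u₁(· + e) ∈ G`
  have h1G : ∀ (x : Site d) (κ : Fin d), (1 : Site d → Fin d → 𝔸ˣ) x κ ∈ G := fun _ _ => G.one_mem
  have hU' : ∀ x κ, U' x κ ∈ unitaryUnits 𝔸 := fun x κ => hGu (hU'G x κ)
  have hu₁ : ∀ x, u₁ x ∈ unitaryUnits 𝔸 := fun x => hGu (hu₁G x)
  have hu₁H : ∀ x, u₁ x ∈ H := fun x => hGH (hu₁G x)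
  have hU₁G : ∀ x κ, U₁ x κ ∈ G := by
    intro x κ
    have h := congrFun (congrFun hW x) κ
    rw [mgauge_apply] at h
    have hU₁ : U₁ x κ = (u₁ x)⁻¹ * U' x κ * Rc ((1 : Site d → Fin d → 𝔸ˣ) x κ) (u₁ (x + e κ)) := by
      rw [← h]; group
    rw [hU₁, Rc_apply]
    exact G.mul_mem (G.mul_mem (G.inv_mem (hu₁G x)) (hU'G x κ))
      (G.mul_mem (G.mul_mem (h1G x κ) (hu₁G _)) (G.inv_mem (h1G x κ)))
  -- the datum's exponent is `τ`-free on every touched side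
  have hAτ : ∀ j, j ≤ m → ∀ b ∈ {b : Site d × Fin d | SideTouches (cubeFam false L aC M ρ k j) b.1 b.2}, τ (A b.1 b.2) = 0 := by
    intro j hj b hb
    obtain ⟨hexp, -, hbd⟩ := hdat j hj b hb
    have hmem : cfgExp η A b.1 b.2 ∈ G := by rw [← hexp]; exact hU₁G b.1 b.2
    refine apply_eq_zero_of_cfgExp_mem τ hGH hGrp2 hη hmem ?_
    have hLj : (1 : ℝ) ≤ (L : ℝ) ^ j := one_le_pow₀ hLr
    calc η * ‖A b.1 b.2‖ ≤ η * ((5 * (d : ℝ) * L * B₀ * (α₀ + α₁)) * ((L : ℝ) ^ j * η)⁻¹) := mul_le_mul_of_nonneg_left hbd hη.le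
      _ = (5 * (d : ℝ) * L * B₀ * (α₀ + α₁)) * ((L : ℝ) ^ j)⁻¹ := by
          field_simp
      _ ≤ (5 * (d : ℝ) * L * B₀ * (α₀ + α₁)) * 1 := mul_le_mul_of_nonneg_left (inv_le_one_of_one_le₀ hLj) hcs0
      _ ≤ 1 / 16 := by linarith only [h16]
  -- the letters at truncation `m + 1` with their `τ`-laws
  obtain ⟨g, Δ, q, qs, Aw, c, H', g_rightΩ, c_range, hΔ, hqs, hq, hH0, hH1, hH2, hHsupp, hHequiv, hQH, hG, hGsupp, hGreal, hRbd, hRreal, hHτ, hGτ, hRτ⟩ :=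
    SLetτ (m + 1) (by omega) hmK
  -- the b9 edge at level `m`
  obtain ⟨len, SB9⟩ := SB9all m hmk.le
  -- THE `τ`-FREE JOIN (lit, BY NAME) at the member
  obtain ⟨lam, hlsa, -, hlτ, h108, hmul, h129'⟩ := sockHFP_body_of_join_RD_traceFree τ hτ hd2 hL hη hGrp2 hGrp3 hGA hGH hGu hΩ hbox hclass hm1 hmk
    htower hlt htop hα₀ hα₁ hB₀ hB₀' rfl rfl h1G hU' h33 h34 hAx h135 hu₁ hu₁H hW h129 hLan hdat hAτ SB9 hα₀9 hcs9 hside hC₂ h61 hsmall₁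
    g Δ q qs Aw c g_rightΩ c_range hΔ hqs hq H' hB₀'H hB₂' hBG hBR hH0 hH1 hH2 hHsupp hHequiv hQH hG hGsupp hGreal hRbd hRreal hHτ hGτ hRτ
    le_rfl le_rfl hcDAlo hα3 hα4 hsmall hc₃ hsc hα₃' hs₁ hs₂ hs₃ hs₄ hs₅ hs₆ hs₇ hsm hprod8 rfl rfl rfl rfl hcA' ha₁' hb₁' hθ h103 h106
  -- the `G`-form step adapter (§1) with (G3)
  have h1u : ∀ (x : Site d) (κ : Fin d), (1 : Site d → Fin d → 𝔸ˣ) x κ ∈ unitaryUnits 𝔸 := fun _ _ => (unitaryUnits 𝔸).one_mem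
  exact hP5_step_mem_of_HFP hd2 hη L m G h1u hα84 hcs12 _ _ u₁ U₁ A hdat lam (hG3 lam hlsa hlτ) h108 hmul h129'

end Summit.QuantumFields.YangMills.Theorems.HalvingHSiteRawP5OfLeaf

end
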